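import Summits.ABC.IUTFork.Joshi.InitialThetaDataJoshi
import Literature.NumberTheory.EllipticCurves.LegendreDescentProofs
import Literature.NumberTheory.EllipticCurves.DivisionFieldRamificationDividesProofs
import Literature.NumberTheory.EllipticCurves.TorsionCardinality
import Mathlib.FieldTheory.KrullTopology
import HarnessLib

/-!
# [J-III] §3 — DISCHARGE of the DERIVABLE rows of `Joshi/InitialThetaDataJoshi.lean`: Lemma 3.4.2.1 and the `2ℓ`-torsion claim of §3.4.1

Proof-only companion (theorems only; no definition, no named fact, no instance) of
`Summits/ABC/IUTFork/Joshi/InitialThetaDataJoshi.lean` (abc-iut-E-t6, p428841; rung LADDER-ABC:A2.E, slot T-06).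
TAKES NO SIDE on [IUTchIII] Cor. 3.12 or on any author; typed ≠ proved — except that the two rows below ARE now
proved, in kernel, from Joshi's typed data (1)–(14) ALONE ([J-III] = K. Joshi, arXiv:2401.13508v4, §3):

* `InitialThetaData.lemma3421_holds : Lemma3421` (for the data's `L`, `L'`, `ℓ`; the statement's parameters are implicit) — **[J-III] Lemma 3.4.2.1** (p.29 l.24–36): `L'/L` is finite of
  degree `≤ |GL₂(ℤ/ℓ)|`. Print's proof («`Gal(L'/L) ⊂ GL₂(ℤ/ℓ)`») formalised as: `G_L = Gal(L̄/L)` acts on the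
  `ℓ`-torsion `C[ℓ](L̄)` (`#C[ℓ](L̄) = ℓ²`, the tree's `WeierstrassCurve.card_torsionBy_eq_sq`, Silverman AEC
  III.6.4); by (13) the kernel of `ρ : G_L → Aut(C[ℓ](L̄))` fixes the image of `L'` in `L̄`, so by the Galois
  correspondence for `L̄/L` (`IntermediateField.finrank_eq_fixingSubgroup_index`) `[L' : L]` divides
  `#im ρ ∣ #Aut(C[ℓ](L̄)) = (ℓ²−1)(ℓ²−ℓ) = |GL₂(𝔽_ℓ)|` (the tree's `natCard_addAut_eq_of_natCard_eq_sq`, Mathlib's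
  `Matrix.card_GL_field`). For this theorem `L̄` is taken in the universe of `L` (the tree's Galois action on
  points, `WeierstrassCurve.instDistribMulActionAlgEquivPoint`, is so typed).
* `InitialThetaData.torsionPointOrderTwoL_holds : D.TorsionPointOrderTwoL` — **[J-III] §3.4.1** (p.29 l.9–16): at
  every `w ∈ V^{odd,ss}` over `v ∈ V^{odd,ss}_L`, `C` has an `L'_w`-point of exact order `2ℓ`. In fact the
  hypotheses on `w`, `v` are idle: by (10) a point of order `2` of `C(L̄)` (a root of the `2`-division cubic in the
  algebraically closed `L̄`, the tree's `exists_two_torsion_point_of_mem_roots`) is `L`-rational, by (12)–(13) a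
  basis vector of `C[ℓ](L̄)` is `L'`-rational (`mem_range_map_of_fixesTorsion`, the replay for Joshi's data of the
  tree's `Literature.IUT.HodgeTheaters.InitialThetaData.mem_range_baseChange_of_fixesTorsion`), their sum has order
  `2ℓ` (`ℓ` odd), and `C(L') ↪ C(L'_w)`. So `C[2ℓ](L') = C[2ℓ](L̄)` is GLOBAL — stronger than printed.

The «in particular» clause of §3.4.1 (`TateParameterRootTwoL`: a `2ℓ`-th root of the Tate parameter in `L'_w`)
needs Tate uniformisation over `L'_w`, i.e. SPLIT multiplicative reduction at `w` (the tree's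
`exists_pow_eq_tateParameter_of_torsion_at`; cf. `InitialThetaDataQRootProofs` for [IUTchI] Ex. 3.2 (iv)); under
the typed multiplicative reading of (6) it is open here (READING flag of the statement file). Inputs: Mathlib and
LANDED tree theorems only; no new `Prop` fact. [claim: Joshi2024ATS3, status: disputed]
-/

noncomputable section

open scoped Classical
open NumberField IsDedekindDomain WeierstrassCurve
open Literature.IUT.HodgeTheaters hiding InitialThetaData

universe u v w

namespace Summit.ABC.IUTFork.Joshi.ATS3.InitialThetaData

/-! ## Transport helpers -/

/-- Transport of a point of given order along an EQUALITY of Weierstrass curves. [folklore] -/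
private theorem exists_point_addOrderOf_eq_of_eq {K : Type*} [Field K] {W₁ W₂ : WeierstrassCurve K}
    (h : W₁ = W₂) {n : ℕ} (P : W₁.toAffine.Point) (hP : addOrderOf P = n) :
    ∃ Q : W₂.toAffine.Point, addOrderOf Q = n := by
  subst h
  exact ⟨P, hP⟩

/-! ## (13) ⟹ descent of `G`-fixed geometric points to `L'` -/

section Descent

variable {L : Type u} {L' : Type v} {Lbar : Type w} [Field L] [NumberField L] [Field L'] [NumberField L']
  [Algebra L L'] [Field Lbar] [Algebra L Lbar] [Algebra L' Lbar] {C : WeierstrassCurve L} [C.IsElliptic]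
  {ℓ : ℕ} (D : InitialThetaData L L' Lbar C ℓ)

include D

/-- **Descent to `L'` of geometric points fixed by `ker ρ_{C/L;ℓ}`** (replay, for Joshi's data, of the tree's
`Literature.IUT.HodgeTheaters.InitialThetaData.mem_range_baseChange_of_fixesTorsion`): a point of `C(L̄)` fixed
by every `σ ∈ G_L` acting trivially on `C[ℓ](L̄)` comes from `C(L')` — its coordinates lie in `L'`, the fixed
field of `ker ρ_{C/L;ℓ}` ((13), `range_iff`). [claim: Joshi2024ATS3, status: disputed] -/
theorem mem_range_map_of_fixesTorsion [IsScalarTower L L' Lbar] (T : GeomPoints Lbar C)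
    (hT : ∀ σ : Lbar ≃ₐ[L] Lbar, FixesTorsion C ℓ σ → galoisAct C σ T = T) :
    ∃ T₀ : (C.toAffine.baseChange L').Point,
      Affine.Point.map (W' := C.toAffine) (IsScalarTower.toAlgHom L L' Lbar) T₀ = T := by
  rcases T with _ | ⟨x, y, h⟩
  · exact ⟨0, rfl⟩
  · have hx : x ∈ Set.range (algebraMap L' Lbar) := by
      rw [D.range_iff]
      intro σ hσ
      have h1 := hT σ hσ
      rw [galoisAct, Affine.Point.map_some, Affine.Point.some.injEq] at h1
      exact h1.1
    have hy : y ∈ Set.range (algebraMap L' Lbar) := by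
      rw [D.range_iff]
      intro σ hσ
      have h1 := hT σ hσ
      rw [galoisAct, Affine.Point.map_some, Affine.Point.some.injEq] at h1
      exact h1.2
    obtain ⟨x₀, rfl⟩ := hx
    obtain ⟨y₀, rfl⟩ := hy
    have h₀ : (C.toAffine.baseChange L').Nonsingular x₀ y₀ :=
      (C.toAffine.baseChange_nonsingular (f := IsScalarTower.toAlgHom L L' Lbar)
        (algebraMap L' Lbar).injective x₀ y₀).mp h
    exact ⟨Affine.Point.some x₀ y₀ h₀, rfl⟩

/-- Every `ℓ`-torsion point of `C(L̄)` comes from `C(L')` («`L' = L(C[ℓ])`», (13)). [claim: Joshi2024ATS3, status: disputed] -/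
theorem mem_range_map_of_l_torsion [IsScalarTower L L' Lbar] (T : GeomPoints Lbar C) (hT : (ℓ : ℤ) • T = 0) :
    ∃ T₀ : (C.toAffine.baseChange L').Point,
      Affine.Point.map (W' := C.toAffine) (IsScalarTower.toAlgHom L L' Lbar) T₀ = T :=
  D.mem_range_map_of_fixesTorsion T fun _ hσ => hσ T hT

end Descent

/-! ## [J-III] §3.4.1: a point of exact order `2ℓ` over `L'_w` -/

section Torsion

variable {L : Type u} {L' : Type v} {Lbar : Type w} [Field L] [NumberField L] [Field L'] [NumberField L']
  [Algebra L L'] [Field Lbar] [Algebra L Lbar] [Algebra L' Lbar] {C : WeierstrassCurve L} [C.IsElliptic]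
  {ℓ : ℕ} (D : InitialThetaData L L' Lbar C ℓ)

include D

/-- **A point of `C(L')` of exact order `2ℓ`** from (10), (11), (12), (13): a point of order `2` (a root of the
`2`-division cubic in `L̄`, `L`-rational by (10)) plus a basis vector of `C[ℓ](L̄)` (`L'`-rational by (13));
the orders `2` and `ℓ` are coprime (`ℓ ≥ 5`). PROVED. [claim: Joshi2024ATS3, status: disputed] -/
theorem exists_point_addOrderOf_two_mul_l :
    ∃ R : (C.toAffine.baseChange L').Point, addOrderOf R = 2 * ℓ := by
  haveI := D.isAlgClosure
  haveI := D.isScalarTower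
  haveI : IsAlgClosed Lbar := IsAlgClosure.isAlgClosed L
  haveI : CharZero Lbar := charZero_of_injective_algebraMap (algebraMap L Lbar).injective
  haveI : (C.baseChange Lbar).IsElliptic := inferInstanceAs (C.map (algebraMap L Lbar)).IsElliptic
  haveI : Fact ℓ.Prime := ⟨D.prime⟩
  haveI : Fact (Nat.Prime 2) := ⟨Nat.prime_two⟩
  -- the comparison map `C(L') ↪ C(L̄)`
  set j : (C.toAffine.baseChange L').Point →+ (C.toAffine.baseChange Lbar).Point :=
    Affine.Point.map (W' := C.toAffine) (IsScalarTower.toAlgHom L L' Lbar) with hj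
  have hjinj : Function.Injective j := Affine.Point.map_injective _
  -- (a) a geometric point of order `2`, rational over `L` by (10)
  have ha : (C.baseChange Lbar).twoTorsionPolynomial.a ≠ 0 := by show (4 : Lbar) ≠ 0; norm_num
  have h0 := Cubic.ne_zero_of_a_ne_zero ha
  obtain ⟨e, he⟩ := IsAlgClosed.exists_root (C.baseChange Lbar).twoTorsionPolynomial.toPoly
    (by rw [Cubic.degree_of_a_ne_zero ha]; norm_num)
  have he' : e ∈ (C.baseChange Lbar).twoTorsionPolynomial.roots := (Polynomial.mem_roots h0).mpr he
  obtain ⟨y, hns, h2⟩ := (C.baseChange Lbar).exists_two_torsion_point_of_mem_roots he'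
  obtain ⟨T₀, hT₀⟩ := D.torsion_six_rational (Affine.Point.some e y hns)
    (by rw [show (6 : ℤ) = 3 * 2 by norm_num, mul_smul, h2, smul_zero])
  set T₁ : (C.toAffine.baseChange L').Point := Affine.Point.baseChange (W' := C.toAffine) L L' T₀ with hT₁
  have hjT₁ : j T₁ = Affine.Point.some e y hns := by
    rw [hj, hT₁, Affine.Point.map_baseChange]
    exact hT₀
  have hT₁two : 2 • T₁ = 0 := hjinj (by
    rw [map_nsmul, hjT₁, map_zero, ← natCast_zsmul, Nat.cast_ofNat]
    exact h2)
  have hT₁ne : T₁ ≠ 0 := by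
    intro h
    rw [h, map_zero] at hjT₁
    exact Affine.Point.some_ne_zero _ hjT₁.symm
  have hordT₁ : addOrderOf T₁ = 2 := addOrderOf_eq_prime hT₁two hT₁ne
  -- (b) a geometric point of order `ℓ`, rational over `L'` by (13)
  obtain ⟨P, Q, hP, -, hind, -, -⟩ := D.imageContainsSL2.exists_basis
  have hPne : P ≠ 0 := by
    intro hP0
    have h1 : (ℓ : ℤ) ∣ 1 := (hind 1 0 (by rw [hP0, one_smul, zero_smul, add_zero])).1
    have h2' : (ℓ : ℤ) = 1 := Int.eq_one_of_dvd_one (by positivity) h1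
    exact D.prime.ne_one (by exact_mod_cast h2')
  obtain ⟨P₀, hP₀⟩ := D.mem_range_map_of_l_torsion P hP
  have hP₀l : ℓ • P₀ = 0 := hjinj (by
    rw [map_nsmul, hj, hP₀, map_zero, ← natCast_zsmul]
    exact hP)
  have hP₀ne : P₀ ≠ 0 := by
    intro h
    rw [h, map_zero] at hP₀
    exact hPne hP₀.symm
  have hordP₀ : addOrderOf P₀ = ℓ := addOrderOf_eq_prime hP₀l hP₀ne
  -- (c) the sum has order `2ℓ`
  have hcop : Nat.Coprime (addOrderOf T₁) (addOrderOf P₀) := by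
    rw [hordT₁, hordP₀]
    exact (Nat.coprime_primes Nat.prime_two D.prime).mpr (by have := D.five_le; omega)
  refine ⟨T₁ + P₀, ?_⟩
  rw [(AddCommute.all T₁ P₀).addOrderOf_add_eq_mul_addOrderOf_of_coprime hcop, hordT₁, hordP₀]

/-- **[J-III] §3.4.1 HOLDS over the typed signature** (p.29 l.9–16): `C/L'_w` has a point of exact order `2ℓ`
defined over `L'_w` — at EVERY place `w` (the printed hypotheses `w ∈ V^{odd,ss}`, `v ∈ V^{odd,ss}_L` are not
used): push the global point of `exists_point_addOrderOf_two_mul_l` along `C(L') ↪ C(L'_w)`. DISCHARGED row.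
[claim: Joshi2024ATS3, status: disputed] -/
theorem torsionPointOrderTwoL_holds : D.TorsionPointOrderTwoL := by
  intro w₀ _ _ _ _ _
  haveI := D.isScalarTower
  obtain ⟨R, hR⟩ := D.exists_point_addOrderOf_two_mul_l
  -- `C(L') ↪ C(L'_w)` (points of `C ×_L L'_w`)
  let Kw := w₀.maximalIdeal.adicCompletion L'
  let f : L' →ₐ[L] Kw := IsScalarTower.toAlgHom L L' Kw
  let ι : (C.toAffine.baseChange L').Point →+ (C.toAffine.baseChange Kw).Point := Affine.Point.map f
  have hι : Function.Injective ι := Affine.Point.map_injective f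
  have hord : addOrderOf (ι R) = 2 * ℓ := by rw [addOrderOf_injective ι hι, hR]
  -- the curves `C ×_L L'_w` and `(C ×_L L') ×_{L'} L'_w` coincide
  have hEq : C.baseChange Kw = (C.baseChange L').baseChange Kw := by
    rw [WeierstrassCurve.baseChange, WeierstrassCurve.baseChange, WeierstrassCurve.baseChange,
      WeierstrassCurve.map_map, ← IsScalarTower.algebraMap_eq]
  exact exists_point_addOrderOf_eq_of_eq hEq (ι R) hord

end Torsion

/-! ## [J-III] Lemma 3.4.2.1: `[L' : L] ≤ |GL₂(ℤ/ℓ)|` -/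

section Degree

variable {L : Type u} {L' : Type v} {Lbar : Type u} [Field L] [NumberField L] [Field L'] [NumberField L']
  [Algebra L L'] [Field Lbar] [Algebra L Lbar] [Algebra L' Lbar] {C : WeierstrassCurve L} [C.IsElliptic]
  {ℓ : ℕ} (D : InitialThetaData L L' Lbar C ℓ)

include D

/-- **[J-III] Lemma 3.4.2.1 HOLDS over the typed signature** (p.29 l.24–36; `L̄` in the universe of `L`):
`L'/L` is finite and `[L' : L] ≤ |GL₂(ℤ/ℓ)|`. Print: «the degree of the fixed field of `ker(ρ_{C/L;ℓ})` is
bounded by the order of the Galois group of `L'/L` and … `Gal(L'/L) ⊂ GL₂(ℤ/ℓ)`». Kernel route: `[L' : L] =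
[G_L : Gal(L̄/L')]` (Galois correspondence for `L̄/L`) divides `[G_L : ker ρ] = #im ρ`, `ρ : G_L → Aut(C[ℓ](L̄))`
(by (13) `ker ρ` fixes `L'`), which divides `#Aut(C[ℓ](L̄)) = (ℓ²−1)(ℓ²−ℓ) = |GL₂(𝔽_ℓ)|` (`#C[ℓ](L̄) = ℓ²`).
DISCHARGED row. [claim: Joshi2024ATS3, status: disputed] -/
theorem lemma3421_holds : Lemma3421 (L := L) (L' := L') (ℓ := ℓ) := by
  haveI := D.isAlgClosure
  haveI := D.isScalarTower
  haveI : IsAlgClosed Lbar := IsAlgClosure.isAlgClosed L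
  haveI : IsGalois L Lbar := IsAlgClosure.isGalois L Lbar
  haveI : Fact ℓ.Prime := ⟨D.prime⟩
  haveI : CharZero Lbar := charZero_of_injective_algebraMap (algebraMap L Lbar).injective
  haveI : (C.baseChange Lbar).IsElliptic := inferInstanceAs (C.map (algebraMap L Lbar)).IsElliptic
  -- the `ℓ`-torsion `T = C[ℓ](L̄)` with its `G_L`-action and `ρ : G_L → Aut(T)`
  let T := WeierstrassCurve.torsionPoints C Lbar (ℓ : ℤ)
  let ρ := DistribMulAction.toAddAut (Lbar ≃ₐ[L] Lbar) T
  -- (i) `#T = ℓ²`, `#Aut(T) = (ℓ² − 1)(ℓ² − ℓ) = |GL₂(𝔽_ℓ)| > 0`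
  have hT : Nat.card T = ℓ ^ 2 :=
    WeierstrassCurve.card_torsionBy_eq_sq (E := C.baseChange Lbar) (by exact_mod_cast D.prime.ne_zero)
  have hAut : Nat.card (AddAut T) = (ℓ ^ 2 - 1) * (ℓ ^ 2 - ℓ) := by
    letI : Module (ZMod ℓ) T := AddSubgroup.torsionBy.zmodModule
    exact Literature.NumberTheory.EllipticCurves.natCard_addAut_eq_of_natCard_eq_sq hT
  have hGL : Nat.card (GL (Fin 2) (ZMod ℓ)) = (ℓ ^ 2 - 1) * (ℓ ^ 2 - ℓ) := by
    rw [Matrix.card_GL_field, Fin.prod_univ_two, ZMod.card]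
    simp
  have hpos : 0 < (ℓ ^ 2 - 1) * (ℓ ^ 2 - ℓ) := by
    have h5 := D.five_le
    have h2 : ℓ * 2 ≤ ℓ ^ 2 := by rw [sq]; exact Nat.mul_le_mul_left _ (by omega)
    exact Nat.mul_pos (by omega) (by omega)
  -- (ii) by (13), `ker ρ` fixes the image `M` of `L'` in `L̄`
  let f : L' →ₐ[L] Lbar := IsScalarTower.toAlgHom L L' Lbar
  let M : IntermediateField L Lbar := f.fieldRange
  have hker : ρ.ker ≤ M.fixingSubgroup := by
    intro σ hσ
    have h1 : ρ σ = 1 := hσ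
    rw [IntermediateField.mem_fixingSubgroup_iff]
    intro x hx
    obtain ⟨z, rfl⟩ := AlgHom.mem_fieldRange.mp hx
    refine (D.range_iff (f z)).mp ⟨z, rfl⟩ σ fun P hP => ?_
    have hPT : P ∈ T := (WeierstrassCurve.mem_torsionPoints_iff C Lbar P).mpr hP
    have h2 : σ • (⟨P, hPT⟩ : T) = ⟨P, hPT⟩ := by
      change (Multiplicative.toAdd (ρ σ)) ⟨P, hPT⟩ = ⟨P, hPT⟩
      rw [h1]
      rfl
    exact congrArg Subtype.val h2
  -- (iii) `[L̄^{fix} : …]`: `finrank L M = index (fixingSubgroup M) ∣ #im ρ ∣ #Aut(T)`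
  have hidx : M.fixingSubgroup.index ∣ Nat.card (AddAut T) := by
    have h1 : M.fixingSubgroup.index ∣ ρ.ker.index := Subgroup.index_dvd_of_le hker
    rw [Subgroup.index_ker] at h1
    refine h1.trans ?_
    rw [← Nat.card_congr (Multiplicative.toAdd (α := AddAut T))]
    exact Subgroup.card_subgroup_dvd_card ρ.range
  have hfinM : Module.finrank L M = M.fixingSubgroup.index := IntermediateField.finrank_eq_fixingSubgroup_index M
  rw [hAut] at hidx
  have hMle : Module.finrank L M ≤ Nat.card (GL (Fin 2) (ZMod ℓ)) := by
    rw [hGL, hfinM]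
    exact Nat.le_of_dvd hpos hidx
  have hMpos : 0 < Module.finrank L M := by
    rw [hfinM]
    exact Nat.pos_of_dvd_of_pos hidx hpos
  -- (iv) `L' ≅ M`
  have hfr : Module.finrank L L' = Module.finrank L M := f.equivFieldRange.toLinearEquiv.finrank_eq
  refine ⟨?_, ?_⟩
  · exact Module.finite_of_finrank_pos (by rw [hfr]; exact hMpos)
  · rw [hfr]
    exact hMle

/-- Hence (Lemma 3.4.2.1 as printed): the image of `L'` in `L̄` lies in `L_{≤A}` with `A = |GL₂(ℤ/ℓ)|`.
[claim: Joshi2024ATS3, status: disputed] -/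
theorem fieldRange_le_boundedDegreeField [IsScalarTower L L' Lbar] :
    (IsScalarTower.toAlgHom L L' Lbar).fieldRange ≤
      boundedDegreeField L Lbar (Nat.card (GL (Fin 2) (ZMod ℓ))) := by
  obtain ⟨hfd, hle⟩ := D.lemma3421_holds
  have e := (IsScalarTower.toAlgHom L L' Lbar).equivFieldRange.toLinearEquiv
  haveI : FiniteDimensional L (IsScalarTower.toAlgHom L L' Lbar).fieldRange := e.finiteDimensional
  refine le_boundedDegreeField _ inferInstance ?_
  rw [← e.finrank_eq]
  exact_mod_cast hle

end Degree

end Summit.ABC.IUTFork.Joshi.ATS3.InitialThetaData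

end
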